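import Literature.Computability.AlgebraicComplexity.LayeredABPScalarRestriction
import Literature.Computability.AlgebraicComplexity.AlgDetRepr
import Literature.Computability.AlgebraicComplexity.StandardFamilies
import Literature.Computability.AlgebraicComplexity.PermanentIrreducible
import HarnessLib

/-!
# Crux `GrenetZeon.AbelianizationQP` (stmt-ValiantsHypothesis-8063), line `zeon-window` —
# the mechanism INSTANTIATED: Grenet's subset-insertion operators commute, so the permanent is an
# `n × n` diagonal determinant over the algebra they generate, over EVERY field

The mechanism lemma (`GrenetZeonAbelianizationQPCommutingProduct.lean`): pairwise commuting
coefficient matrices make an iterated affine product a small determinant over a commutative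
algebra.  Here is the motivating instance, kernel-checked and characteristic-free.  On the
`2^n`-dimensional space with basis the subsets `S ⊆ [n]`, let `Z_j` be the INSERTION operator
`S ↦ S ∪ {j}` (zero if `j ∈ S`) — the transition structure of Grenet's `(2^n − 1) × (2^n − 1)`
determinant / layered program for `per_n` (Grenet 2011, Thm. 1).  Then

* `insertion_mul_apply`, `insertion_comm` — the `Z_j` pairwise COMMUTE (and square to zero): they
  generate a commutative subalgebra `R ⊆ Mat_{2^n}(K)` (the zeon algebra, Brand–Dell–Husfeldt 2018
  §3, realised by matrices);
* `insertion_list_prod_apply` — a word `Z_{j_1} ⋯ Z_{j_r}` maps `∅` to `[n]` exactly when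
  `(j_1, …, j_r)` is a permutation of `[n]` (path counting in the Boolean lattice);
* `insertionWord_mul`, `finrank_adjoin_insertion_le` — the words `Z_T = ∏_{j ∈ T} Z_j` multiply
  like zeon monomials (`Z_T Z_U = [T ∩ U = ∅] Z_{T ∪ U}`), so the algebra generated by the `Z_j` is
  spanned by the `2^n` words: `dim R ≤ 2^n` (the zeon algebra `K[z_1..z_n]/(z_j²)` realised by
  matrices);
* `hasAlgDetRepr_perPoly_insertion` — hence, for EVERY field `K` and every `n`,
  `per_n = λ(det diag(L_1, …, L_n))` with `L_k = Σ_j x_{jk} Z_j ∈ R[x]` and `λ(r) = r_{∅,[n]}`: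
  the ZEON POINT `(n, 2^n)` of the route over any field (the tree's `zeonPoint_proof` is over `ℂ`
  via Glynn's formula, which needs `2` invertible — this one also covers characteristic `2`).

Honest framing: a worked instance of the abelianization mechanism (the known Grenet ↦ zeon trade,
in the currency `HasAlgDetRepr`), not progress on the crux: the crux asks for the same trade at
QUASI-POLYNOMIAL dimension starting from an ARBITRARY representation.  Axioms `propext`,
`Classical.choice`, `Quot.sound`.

## References
* B. Grenet, *An upper bound for the permanent versus determinant problem* (2011), Thm. 1.
  [Grenet2011]
* C. Brand, H. Dell, T. Husfeldt, *Extensor-coding*, STOC 2018, §3. [BrandDellHusfeldt2018]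
-/

set_option linter.dupNamespace false

noncomputable section

namespace Summit.ValiantsHypothesis.ValiantsHypothesis.Theorems.GrenetZeonAbelianizationQP

open MvPolynomial Matrix
open Literature.Computability.AlgebraicComplexity

variable {K : Type} [Field K] {n : ℕ}

/-- Left multiplication by the insertion operator `Z_j` (`(Z_j)_{S,T} = [j ∉ S, T = S ∪ {j}]`):
`(Z_j P)_{S,T} = [j ∉ S] · P_{S ∪ {j}, T}`. [cite: Grenet2011, Thm. 1] -/
theorem insertion_mul_apply (j : Fin n) (P : Matrix (Finset (Fin n)) (Finset (Fin n)) K)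
    (S T : Finset (Fin n)) :
    ((Matrix.of fun S T : Finset (Fin n) => if j ∉ S ∧ T = insert j S then (1 : K) else 0) * P)
        S T = if j ∉ S then P (insert j S) T else 0 := by
  classical
  rw [Matrix.mul_apply, Finset.sum_eq_single (insert j S)]
  · simp only [Matrix.of_apply, and_true]
    split_ifs <;> simp
  · intro U _ hU
    simp only [Matrix.of_apply]
    rw [if_neg (fun h => hU h.2), zero_mul]
  · intro h
    exact absurd (Finset.mem_univ _) h

/-- **The insertion operators pairwise commute** (inserting `j` then `l` is inserting `l` then
`j`; and `Z_j² = 0`). [cite: BrandDellHusfeldt2018, §3] -/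
theorem insertion_comm (j l : Fin n) :
    (Matrix.of fun S T : Finset (Fin n) => if j ∉ S ∧ T = insert j S then (1 : K) else 0) *
        (Matrix.of fun S T : Finset (Fin n) => if l ∉ S ∧ T = insert l S then (1 : K) else 0) =
      (Matrix.of fun S T : Finset (Fin n) => if l ∉ S ∧ T = insert l S then (1 : K) else 0) *
        (Matrix.of fun S T : Finset (Fin n) => if j ∉ S ∧ T = insert j S then (1 : K) else 0) := by
  classical
  refine Matrix.ext fun S T => ?_
  rw [insertion_mul_apply, insertion_mul_apply, Matrix.of_apply, Matrix.of_apply]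
  by_cases hjl : j = l
  · subst hjl
    rfl
  · rw [Finset.insert_comm l j S]
    by_cases hj : j ∈ S <;> by_cases hl : l ∈ S <;>
      simp [hj, hl, hjl, Ne.symm hjl, Finset.mem_insert]

/-- **Words in the insertion operators count lattice paths**: `(Z_{j_1} ⋯ Z_{j_r})_{S,T} = 1` if the
`j_i` are pairwise distinct, all outside `S`, and `T = S ∪ {j_1, …, j_r}`; otherwise `0`.
[cite: Grenet2011, Thm. 1] -/
theorem insertion_list_prod_apply (js : List (Fin n)) (S T : Finset (Fin n)) :
    ((js.map fun j => (Matrix.of fun S T : Finset (Fin n) =>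
        if j ∉ S ∧ T = insert j S then (1 : K) else 0)).prod) S T =
      if js.Nodup ∧ (∀ j ∈ js, j ∉ S) ∧ T = S ∪ js.toFinset then 1 else 0 := by
  classical
  induction js generalizing S with
  | nil =>
    rw [List.map_nil, List.prod_nil, Matrix.one_apply]
    by_cases hST : S = T
    · subst hST; simp
    · rw [if_neg hST, if_neg]
      rintro ⟨-, -, h⟩
      exact hST (by rw [h, List.toFinset_nil, Finset.union_empty])
  | cons j js ih =>
    rw [List.map_cons, List.prod_cons, insertion_mul_apply, ih]
    by_cases hj : j ∈ S
    · rw [if_neg (not_not.mpr hj), if_neg]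
      rintro ⟨-, hall, -⟩
      exact hall j (List.mem_cons_self) hj
    · rw [if_pos hj]
      by_cases hA : js.Nodup ∧ (∀ l ∈ js, l ∉ insert j S) ∧ T = insert j S ∪ js.toFinset
      · obtain ⟨hnd, hall, hT⟩ := hA
        rw [if_pos ⟨hnd, hall, hT⟩, if_pos]
        refine ⟨List.nodup_cons.mpr ⟨fun hmem => hall j hmem (Finset.mem_insert_self j S), hnd⟩,
          ?_, ?_⟩
        · intro l hl
          rcases List.mem_cons.mp hl with rfl | hl'
          · exact hj
          · exact fun hlS => hall l hl' (Finset.mem_insert_of_mem hlS)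
        · rw [hT, List.toFinset_cons, Finset.insert_union, Finset.union_insert]
      · rw [if_neg hA, if_neg]
        rintro ⟨hnd, hall, hT⟩
        apply hA
        refine ⟨(List.nodup_cons.mp hnd).2, fun l hl hlS => ?_, ?_⟩
        · rcases Finset.mem_insert.mp hlS with rfl | hlS'
          · exact (List.nodup_cons.mp hnd).1 hl
          · exact hall l (List.mem_cons_of_mem j hl) hlS'
        · rw [hT, List.toFinset_cons, Finset.insert_union, Finset.union_insert]

/-- The word of a function `g : [n] → [n]` maps `∅` to `[n]` iff `g` is injective (a permutation).
[cite: Grenet2011, Thm. 1] -/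
theorem insertion_ofFn_prod_apply_empty_univ (g : Fin n → Fin n) :
    (((List.ofFn g).map fun j => (Matrix.of fun S T : Finset (Fin n) =>
        if j ∉ S ∧ T = insert j S then (1 : K) else 0)).prod) ∅ Finset.univ =
      if Function.Injective g then 1 else 0 := by
  classical
  rw [insertion_list_prod_apply]
  by_cases hg : Function.Injective g
  · rw [if_pos hg, if_pos]
    refine ⟨List.nodup_ofFn.mpr hg, fun j _ => Finset.notMem_empty j, ?_⟩
    rw [Finset.empty_union]
    have hsurj : Function.Surjective g := Finite.surjective_of_injective hg
    ext x
    simp only [Finset.mem_univ, List.mem_toFinset, List.mem_ofFn, true_iff]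
    exact hsurj x
  · rw [if_neg hg, if_neg]
    rintro ⟨hnd, -, -⟩
    exact hg (List.nodup_ofFn.mp hnd)

/-- **Word operators multiply like zeon monomials**: with `Z_T = [T ∩ S = ∅, U = S ∪ T]_{S,U}`
(the product of the insertions `Z_j`, `j ∈ T`), `Z_T · Z_U = Z_{T ∪ U}` if `T ∩ U = ∅` and `0`
otherwise. [cite: BrandDellHusfeldt2018, §3] -/
theorem insertionWord_mul (T U : Finset (Fin n)) :
    (Matrix.of fun S V : Finset (Fin n) => if Disjoint T S ∧ V = S ∪ T then (1 : K) else 0) *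
        (Matrix.of fun S V : Finset (Fin n) => if Disjoint U S ∧ V = S ∪ U then (1 : K) else 0) =
      if Disjoint T U then
        (Matrix.of fun S V : Finset (Fin n) =>
          if Disjoint (T ∪ U) S ∧ V = S ∪ (T ∪ U) then (1 : K) else 0)
      else 0 := by
  classical
  refine Matrix.ext fun S V => ?_
  rw [Matrix.mul_apply, Finset.sum_eq_single (S ∪ T)]
  · simp only [Matrix.of_apply, and_true]
    by_cases hTS : Disjoint T S
    · rw [if_pos hTS, one_mul]
      by_cases hTU : Disjoint T U
      · rw [if_pos hTU, Matrix.of_apply]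
        have hiff : (Disjoint U (S ∪ T) ∧ V = S ∪ T ∪ U) ↔
            (Disjoint (T ∪ U) S ∧ V = S ∪ (T ∪ U)) := by
          rw [Finset.disjoint_union_right, Finset.disjoint_union_left, Finset.union_assoc]
          constructor
          · rintro ⟨⟨hUS, -⟩, hV⟩; exact ⟨⟨hTS, hUS⟩, hV⟩
          · rintro ⟨⟨-, hUS⟩, hV⟩; exact ⟨⟨hUS, disjoint_comm.mp hTU⟩, hV⟩
        rw [if_congr hiff rfl rfl]
      · rw [if_neg hTU, Matrix.zero_apply, if_neg]
        rintro ⟨hU, -⟩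
        exact hTU (disjoint_comm.mp (Finset.disjoint_union_right.mp hU).2)
    · rw [if_neg hTS, zero_mul]
      by_cases hTU : Disjoint T U
      · rw [if_pos hTU, Matrix.of_apply, if_neg]
        rintro ⟨hd, -⟩
        exact hTS (Finset.disjoint_union_left.mp hd).1
      · rw [if_neg hTU, Matrix.zero_apply]
  · intro W _ hW
    simp only [Matrix.of_apply]
    rw [if_neg (fun h => hW h.2), zero_mul]
  · intro h
    exact absurd (Finset.mem_univ _) h

/-- The insertion `Z_j` is the word operator of the singleton `{j}`. [cite: BrandDellHusfeldt2018, §3] -/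
theorem insertion_eq_word (j : Fin n) :
    (Matrix.of fun S T : Finset (Fin n) => if j ∉ S ∧ T = insert j S then (1 : K) else 0) =
      Matrix.of fun S V : Finset (Fin n) =>
        if Disjoint ({j} : Finset (Fin n)) S ∧ V = S ∪ {j} then (1 : K) else 0 := by
  classical
  refine Matrix.ext fun S T => ?_
  simp only [Matrix.of_apply, Finset.disjoint_singleton_left, Finset.insert_eq, Finset.union_comm]

/-- The identity is the word operator of `∅`. [folklore] -/
theorem one_eq_word_empty :
    (1 : Matrix (Finset (Fin n)) (Finset (Fin n)) K) =
      Matrix.of fun S V : Finset (Fin n) =>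
        if Disjoint (∅ : Finset (Fin n)) S ∧ V = S ∪ ∅ then (1 : K) else 0 := by
  classical
  refine Matrix.ext fun S V => ?_
  rw [Matrix.one_apply, Matrix.of_apply]
  simp only [Finset.disjoint_empty_left, Finset.union_empty, true_and, eq_comm]

/-- **The insertion algebra is the zeon algebra, of dimension `≤ 2^n`**: the subalgebra of
`Mat_{2^n}(K)` generated by the insertion operators is contained in the span of the `2^n` word
operators `Z_T` (which is a subalgebra: `Z_∅ = 1`, `Z_T Z_U ∈ {Z_{T ∪ U}, 0}`).
[cite: BrandDellHusfeldt2018, §3] -/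
theorem finrank_adjoin_insertion_le (n : ℕ) :
    Module.finrank K (Algebra.adjoin K (Set.range fun j : Fin n =>
      (Matrix.of fun S T : Finset (Fin n) => if j ∉ S ∧ T = insert j S then (1 : K) else 0))) ≤
      2 ^ n := by
  classical
  obtain ⟨w, hw⟩ : ∃ w : Finset (Fin n) → Matrix (Finset (Fin n)) (Finset (Fin n)) K, ∀ T, w T =
      Matrix.of fun S V : Finset (Fin n) => if Disjoint T S ∧ V = S ∪ T then (1 : K) else 0 :=
    ⟨_, fun T => rfl⟩
  have hone : (1 : Matrix (Finset (Fin n)) (Finset (Fin n)) K) ∈ Submodule.span K (Set.range w) := by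
    rw [one_eq_word_empty, ← hw ∅]
    exact Submodule.subset_span ⟨∅, rfl⟩
  have hmul : ∀ x y, x ∈ Submodule.span K (Set.range w) → y ∈ Submodule.span K (Set.range w) →
      x * y ∈ Submodule.span K (Set.range w) := by
    intro x y hx hy
    have hxy : x * y ∈ Submodule.span K (Set.range w) * Submodule.span K (Set.range w) :=
      Submodule.mul_mem_mul hx hy
    rw [Submodule.span_mul_span] at hxy
    refine (Submodule.span_le.mpr ?_) hxy
    rintro _ ⟨a, ⟨T, rfl⟩, b, ⟨U, rfl⟩, rfl⟩
    show w T * w U ∈ Submodule.span K (Set.range w)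
    rw [hw T, hw U, insertionWord_mul]
    by_cases hTU : Disjoint T U
    · rw [if_pos hTU, ← hw (T ∪ U)]
      exact Submodule.subset_span ⟨T ∪ U, rfl⟩
    · rw [if_neg hTU]
      exact Submodule.zero_mem _
  have hle : Algebra.adjoin K (Set.range fun j : Fin n =>
      (Matrix.of fun S T : Finset (Fin n) => if j ∉ S ∧ T = insert j S then (1 : K) else 0)) ≤
      (Submodule.span K (Set.range w)).toSubalgebra hone hmul := by
    refine Algebra.adjoin_le ?_
    rintro _ ⟨j, rfl⟩
    show (Matrix.of fun S T : Finset (Fin n) => if j ∉ S ∧ T = insert j S then (1 : K) else 0) ∈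
      Submodule.span K (Set.range w)
    rw [insertion_eq_word, ← hw {j}]
    exact Submodule.subset_span ⟨{j}, rfl⟩
  have hle' : Subalgebra.toSubmodule (Algebra.adjoin K (Set.range fun j : Fin n =>
      (Matrix.of fun S T : Finset (Fin n) => if j ∉ S ∧ T = insert j S then (1 : K) else 0))) ≤
      Submodule.span K (Set.range w) :=
    fun x hx => Submodule.mem_toSubalgebra.mp (hle hx)
  calc Module.finrank K (Algebra.adjoin K (Set.range fun j : Fin n =>
        (Matrix.of fun S T : Finset (Fin n) => if j ∉ S ∧ T = insert j S then (1 : K) else 0)))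
      = Module.finrank K (Subalgebra.toSubmodule (Algebra.adjoin K (Set.range fun j : Fin n =>
        (Matrix.of fun S T : Finset (Fin n) =>
          if j ∉ S ∧ T = insert j S then (1 : K) else 0)))) :=
        (Subalgebra.finrank_toSubmodule _).symm
    _ ≤ Module.finrank K (Submodule.span K (Set.range w)) := Submodule.finrank_mono hle'
    _ ≤ Fintype.card (Finset (Fin n)) := finrank_range_le_card w
    _ = 2 ^ n := by rw [Fintype.card_finset, Fintype.card_fin]

/-- **The permanent is an `n × n` diagonal determinant over the insertion (zeon) algebra, over
every field**: `HasAlgDetRepr (perPoly (Fin n) K) n (2^n)`.  Coefficient algebra `R` = the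
commutative subalgebra of `Mat_{2^n}(K)` generated by the insertion operators
(`insertion_comm`, `Algebra.isMulCommutative_adjoin`; `dim R ≤ 2^n`,
`finrank_adjoin_insertion_le`); matrix `diag(L_1, …, L_n)` with `L_k = Σ_j x_{jk} · Z_j`; functional
`λ(r) = r_{∅,[n]}`.  Expanding `∏_k L_k = Σ_g (∏_k x_{g(k) k}) · Z_{g(1)} ⋯ Z_{g(n)}` and reading the
`(∅, [n])` entry keeps exactly the permutations (`insertion_ofFn_prod_apply_empty_univ`), i.e.
`per_n = Σ_σ ∏_k x_{σ(k) k}` (`Matrix.permanent`).  The abelianization of Grenet's program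
(Grenet 2011 Thm. 1 ↦ zeons, Brand–Dell–Husfeldt 2018 §3) as an instance of the mechanism lemma.
[cite: Grenet2011, Thm. 1] -/
theorem hasAlgDetRepr_perPoly_insertion (K : Type) [Field K] (n : ℕ) :
    HasAlgDetRepr (perPoly (Fin n) K) n (2 ^ n) := by
  classical
  -- the insertion operators and the commutative algebra they generate
  set Z : Fin n → Matrix (Finset (Fin n)) (Finset (Fin n)) K := fun j =>
    Matrix.of fun S T : Finset (Fin n) => if j ∉ S ∧ T = insert j S then (1 : K) else 0 with hZ
  have hcomm : ∀ x ∈ Set.range Z, ∀ y ∈ Set.range Z, x * y = y * x := by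
    rintro x ⟨j, rfl⟩ y ⟨l, rfl⟩
    exact insertion_comm j l
  set Sgen : Set (Matrix (Finset (Fin n)) (Finset (Fin n)) K) := Set.range Z with hSgen
  haveI hc : IsMulCommutative (Algebra.adjoin K Sgen) := Algebra.isMulCommutative_adjoin K hcomm
  letI : CommRing (Algebra.adjoin K Sgen) :=
    { (inferInstance : Ring (Algebra.adjoin K Sgen)) with mul_comm := mul_comm' }
  have hZmem : ∀ j, Z j ∈ Algebra.adjoin K Sgen := fun j => Algebra.subset_adjoin ⟨j, rfl⟩
  set z : Fin n → Algebra.adjoin K Sgen := fun j => ⟨Z j, hZmem j⟩ with hz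
  -- the affine (indeed linear) forms `L_k = Σ_j x_{jk} z_j`
  set L : Fin n → MvPolynomial (Fin n × Fin n) (Algebra.adjoin K Sgen) := fun k =>
    ∑ j, X (j, k) * C (z j) with hL
  have hLdeg : ∀ k, (L k).totalDegree ≤ 1 := by
    intro k
    refine (totalDegree_finsetSum _ _).trans (Finset.sup_le fun j _ => ?_)
    refine (totalDegree_mul _ _).trans ?_
    rw [totalDegree_C, add_zero]
    rcases subsingleton_or_nontrivial (Algebra.adjoin K Sgen) with h0 | h1
    · rw [Subsingleton.elim (X (j, k) : MvPolynomial (Fin n × Fin n) (Algebra.adjoin K Sgen)) 0,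
        totalDegree_zero]
      exact Nat.zero_le _
    · rw [totalDegree_X]
  -- dimension bound
  have hdim : Module.finrank K (Algebra.adjoin K Sgen) ≤ 2 ^ n := finrank_adjoin_insertion_le n
  -- the read-out functional `r ↦ r_{∅, univ}`
  let l : Algebra.adjoin K Sgen →ₗ[K] K :=
    (Matrix.entryLinearMap K K (∅ : Finset (Fin n)) Finset.univ).comp
      (Algebra.adjoin K Sgen).val.toLinearMap
  have hl : ∀ r : Algebra.adjoin K Sgen, l r = (r : Matrix (Finset (Fin n)) (Finset (Fin n)) K)
      ∅ Finset.univ := fun r => rfl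
  -- expansion of the product of the forms
  have hprod : ∏ k, L k = ∑ g : Fin n → Fin n, (∏ k, X (g k, k)) * C (∏ k, z (g k)) := by
    simp only [hL]
    rw [Finset.prod_univ_sum]
    simp only [Fintype.piFinset_univ]
    refine Finset.sum_congr rfl fun g _ => ?_
    rw [Finset.prod_mul_distrib, map_prod]
  -- value of the functional on a word
  have hword : ∀ g : Fin n → Fin n,
      l (∏ k, z (g k)) = if Function.Injective g then 1 else 0 := by
    intro g
    have h := insertion_ofFn_prod_apply_empty_univ (K := K) g
    rw [List.map_ofFn] at h
    rw [hl, ← List.prod_ofFn,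
      show (((List.ofFn fun k => z (g k)).prod : Algebra.adjoin K Sgen) :
          Matrix (Finset (Fin n)) (Finset (Fin n)) K) =
        (Algebra.adjoin K Sgen).val (List.ofFn fun k => z (g k)).prod from rfl,
      map_list_prod, List.map_ofFn]
    exact h
  -- the monomial of a function `g`
  have hmon : ∀ g : Fin n → Fin n,
      (∏ k, X (g k, k) : MvPolynomial (Fin n × Fin n) (Algebra.adjoin K Sgen)) =
        monomial (∑ k, Finsupp.single (g k, k) 1) 1 := by
    intro g
    rw [monomial_sum_one]
    rfl
  refine HasAlgDetRepr.of_data (Algebra.adjoin K Sgen) hdim l (Matrix.diagonal L)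
    (fun i j => ?_) (fun d => ?_)
  · rw [Matrix.diagonal_apply]
    split_ifs
    · exact hLdeg i
    · rw [totalDegree_zero]; exact Nat.zero_le _
  · rw [Matrix.det_diagonal, hprod, coeff_sum, map_sum, coeff_perPoly]
    have hterm : ∀ g : Fin n → Fin n,
        l (coeff d ((∏ k, X (g k, k)) * C (∏ k, z (g k)))) =
          if Function.Injective g then
            (if (∑ k, Finsupp.single (g k, k) 1) = d then (1 : K) else 0) else 0 := by
      intro g
      rw [hmon g, mul_comm, C_mul_monomial, mul_one, coeff_monomial]
      by_cases h1 : (∑ k, Finsupp.single (g k, k) 1) = d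
      · rw [if_pos h1, if_pos h1]
        exact hword g
      · rw [if_neg h1, if_neg h1, map_zero, ite_self]
    simp only [hterm]
    rw [← Finset.sum_filter]
    refine Finset.sum_bij' (fun g hg => Equiv.ofBijective g
        (Finite.injective_iff_bijective.mp (Finset.mem_filter.mp hg).2))
      (fun σ _ => (σ : Fin n → Fin n)) ?_ ?_ ?_ ?_ ?_
    · intro g hg; exact Finset.mem_univ _
    · intro σ _; exact Finset.mem_filter.mpr ⟨Finset.mem_univ _, σ.injective⟩
    · intro g hg; rfl
    · intro σ _; ext x; rfl
    · intro g hg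
      simp only [permMonomial, Equiv.ofBijective_apply]
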